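import Summits.Ventures.YMGap.RobustBall.TrailLoopFamily
import Summits.Ventures.YMGap.RobustBall.RectangleLoopFamily
import HarnessLib

/-!
# Venture YMGap, track ROBUST-BALL — a non-degenerate lattice RECTANGLE IS A CLOSED TRAIL: the rectangle family sits inside
# the trail family

HONEST FRAMING. WHAT THIS IS: a venture file (cell `pub-ymgap`, track Y2 ROBUST-BALL, seat rb-p1), lattice geometry linking the two
concrete loop families of the track: for `i ≠ j` and `R, T ≥ 1` the rectangle `rectWalk x i j R T` of `ℤ^d` traverses no link twice
(`isTrail_rectWalk`; the oriented edges under its `2(R+T)` darts are pairwise distinct, `nodup_dartSteps_rectWalk`; tree `Dart.edge_eq_of_dartStep`, `ZdEdge.toSym2` + its injectivity here), so every index of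
the rectangle family `rectLoop` is an index of the trail family `trailLoop` (`rectLoop_mem_range_trailLoop`) — the all-closed-trails
theorems of `TrailLoopFamily.lean` cover the rectangle actions of `RectangleLoopFamily.lean`. WHAT IT IS NOT: no measure, no number;
nothing about the continuum limit or the Clay problem.

References: Mathlib `SimpleGraph.Walk.IsTrail`; this track's `RectangleEdges.lean`, `LoopObservable.lean`. [folklore]
-/

noncomputable section

open Function SimpleGraph
open Literature.Probability.LatticeModels
open Literature.MathematicalPhysics.QuantumLattice
open Literature.MathematicalPhysics.QuantumFieldTheory (walkEdges)

namespace Summit.Ventures.YMGap.RobustBall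

variable {d : ℕ}

/-! ### A walk is a trail iff its oriented edges are pairwise distinct -/

/-- The map `(z, k) ↦ {z, z + e_k}` (tree `ZdEdge.toSym2`) is injective on `ℤ^d`. -/
theorem injective_zdEdge_toSym2 :
    Injective (Literature.MathematicalPhysics.QuantumFieldTheory.ZdEdge.toSym2 (d := d)) := by
  rintro ⟨z, k⟩ ⟨z', k'⟩ h
  unfold Literature.MathematicalPhysics.QuantumFieldTheory.ZdEdge.toSym2 at h
  simp only at h
  rcases Sym2.eq_iff.1 h with ⟨h1, h2⟩ | ⟨h1, h2⟩
  · subst h1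
    have hk : (Pi.single k (1 : ℤ) : Site d) = Pi.single k' 1 := add_left_cancel h2
    have hkk : k = k' := by
      by_contra hne
      have h3 := congrFun hk k
      rw [Pi.single_eq_same, Pi.single_eq_of_ne hne] at h3
      exact one_ne_zero h3
    subst hkk; rfl
  · exfalso
    have h3 := congrFun h2 k
    rw [h1] at h3
    simp only [Pi.add_apply, Pi.single_eq_same] at h3
    have h4 : (Pi.single k' (1 : ℤ) : Site d) k = 0 ∨ (Pi.single k' (1 : ℤ) : Site d) k = 1 := by
      by_cases hkk : k = k'
      · subst hkk; simp
      · left; rw [Pi.single_eq_of_ne hkk]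
    omega

/-- A walk is a trail iff the oriented edges under its darts are pairwise distinct (one direction is the tree's
`nodup_map_dartStep_of_isTrail`). -/
theorem isTrail_iff_nodup_dartSteps {x y : Site d} (w : (zdGraph d).Walk x y) :
    w.IsTrail ↔ (w.darts.map fun a => (dartStep a).1).Nodup := by
  refine ⟨Literature.MathematicalPhysics.QuantumFieldTheory.nodup_map_dartStep_of_isTrail, fun h => ?_⟩
  rw [Walk.isTrail_def]
  have hmap : w.edges = (w.darts.map fun a => (dartStep a).1).map
      Literature.MathematicalPhysics.QuantumFieldTheory.ZdEdge.toSym2 := by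
    unfold Walk.edges
    rw [List.map_map]
    exact List.map_congr_left fun a _ => Literature.MathematicalPhysics.QuantumFieldTheory.Dart.edge_eq_of_dartStep a
  rw [hmap]
  exact List.Nodup.map injective_zdEdge_toSym2 h

/-! ### The oriented edges of straight walks and rectangles, as lists -/

/-- The oriented edges of a straight walk, in order: `(x + k e_i, i)`, `k = 0, …, n − 1`. -/
theorem dartSteps_lineWalk (i : Fin d) : ∀ (n : ℕ) (x : Site d),
    ((lineWalk i n x).darts.map fun a => (dartStep a).1) = (List.range n).map fun k : ℕ => (x + Pi.single i (k : ℤ), i)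
  | 0, x => by simp [lineWalk]
  | n + 1, x => by
    rw [lineWalk, Walk.darts_cons, Walk.darts_copy, List.map_cons, dartStep_add_single, dartSteps_lineWalk i n,
      List.range_succ_eq_map, List.map_cons, List.map_map]
    simp only [Nat.cast_zero, Pi.single_zero, add_zero]
    congr 1
    refine List.map_congr_left fun k _ => ?_
    simp only [comp_apply, Nat.succ_eq_add_one, Nat.cast_add, Nat.cast_one, Pi.single_add]
    abel

/-- The oriented edges of a straight walk are pairwise distinct. -/
theorem nodup_dartSteps_lineWalk (i : Fin d) (n : ℕ) (x : Site d) :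
    ((lineWalk i n x).darts.map fun a => (dartStep a).1).Nodup := by
  rw [dartSteps_lineWalk]
  refine List.Nodup.map (fun k k' h => ?_) List.nodup_range
  have h1 := congrArg (fun e : ZdEdge d => e.1 i) h
  simp only [Pi.add_apply, Pi.single_eq_same, add_right_inj, Nat.cast_inj] at h1
  exact h1

/-- Reversal permutes the oriented edges under the darts. -/
theorem dartSteps_reverse {x y : Site d} (w : (zdGraph d).Walk x y) :
    (w.reverse.darts.map fun a => (dartStep a).1) = (w.darts.map fun a => (dartStep a).1).reverse := by
  rw [Walk.darts_reverse, List.map_reverse, List.map_map]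
  congr 1
  exact List.map_congr_left fun a _ => by simp [dartStep_symm]

/-- Membership in the oriented-edge list is membership in `walkEdges`. -/
theorem mem_dartSteps_iff {x y : Site d} (w : (zdGraph d).Walk x y) (e : ZdEdge d) :
    e ∈ (w.darts.map fun a => (dartStep a).1) ↔ e ∈ walkEdges w := by
  unfold walkEdges; rw [List.mem_toFinset]

/-! ### Rectangles are trails -/

/-- **The oriented edges of a non-degenerate rectangle are pairwise distinct** (`i ≠ j`, `R, T ≥ 1`). -/
theorem nodup_dartSteps_rectWalk {x : Site d} {i j : Fin d} (hij : i ≠ j) {R T : ℕ} (hR : 1 ≤ R) (hT : 1 ≤ T) :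
    ((rectWalk x i j R T).darts.map fun a => (dartStep a).1).Nodup := by
  -- side membership predicates
  have hA : ∀ e ∈ ((lineWalk i R x).darts.map fun a => (dartStep a).1), ∃ k : ℕ, k < R ∧ e = (x + Pi.single i (k : ℤ), i) :=
    fun e he => (mem_walkEdges_lineWalk_iff i R x e).1 ((mem_dartSteps_iff _ e).1 he)
  have hB : ∀ e ∈ (((lineWalk j T (x + Pi.single i (R : ℤ))).copy rfl (add_right_comm _ _ _)).darts.map
      fun a => (dartStep a).1), ∃ k : ℕ, k < T ∧ e = (x + Pi.single i (R : ℤ) + Pi.single j (k : ℤ), j) := by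
    intro e he
    rw [Walk.darts_copy] at he
    exact (mem_walkEdges_lineWalk_iff j T _ e).1 ((mem_dartSteps_iff _ e).1 he)
  have hC : ∀ e ∈ ((lineWalk i R (x + Pi.single j (T : ℤ))).reverse.darts.map fun a => (dartStep a).1),
      ∃ k : ℕ, k < R ∧ e = (x + Pi.single j (T : ℤ) + Pi.single i (k : ℤ), i) := by
    intro e he
    rw [dartSteps_reverse, List.mem_reverse] at he
    exact (mem_walkEdges_lineWalk_iff i R _ e).1 ((mem_dartSteps_iff _ e).1 he)
  have hD : ∀ e ∈ ((lineWalk j T x).reverse.darts.map fun a => (dartStep a).1),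
      ∃ k : ℕ, k < T ∧ e = (x + Pi.single j (k : ℤ), j) := by
    intro e he
    rw [dartSteps_reverse, List.mem_reverse] at he
    exact (mem_walkEdges_lineWalk_iff j T x e).1 ((mem_dartSteps_iff _ e).1 he)
  -- A ∩ C = ∅ : compare the `j`-coordinate
  have hAC : ∀ e, (∃ k : ℕ, k < R ∧ e = (x + Pi.single i (k : ℤ), i)) →
      (∃ k : ℕ, k < R ∧ e = (x + Pi.single j (T : ℤ) + Pi.single i (k : ℤ), i)) → False := by
    rintro e ⟨k, -, rfl⟩ ⟨k', -, h⟩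
    have h1 := congrArg (fun e : ZdEdge d => e.1 j) h
    simp only [Pi.add_apply, Pi.single_eq_same, Pi.single_eq_of_ne hij.symm] at h1
    omega
  -- B ∩ D = ∅ : compare the `i`-coordinate
  have hBD : ∀ e, (∃ k : ℕ, k < T ∧ e = (x + Pi.single i (R : ℤ) + Pi.single j (k : ℤ), j)) →
      (∃ k : ℕ, k < T ∧ e = (x + Pi.single j (k : ℤ), j)) → False := by
    rintro e ⟨k, -, rfl⟩ ⟨k', -, h⟩
    have h1 := congrArg (fun e : ZdEdge d => e.1 i) h
    simp only [Pi.add_apply, Pi.single_eq_same, Pi.single_eq_of_ne hij] at h1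
    omega
  rw [rectWalk, Walk.darts_append, Walk.darts_append, Walk.darts_append, List.map_append, List.map_append, List.map_append]
  rw [List.nodup_append]
  refine ⟨nodup_dartSteps_lineWalk i R x, ?_, fun a ha b hb hab => ?_⟩
  · rw [List.nodup_append]
    refine ⟨by rw [Walk.darts_copy]; exact nodup_dartSteps_lineWalk j T _, ?_, fun a ha b hb hab => ?_⟩
    · rw [List.nodup_append]
      refine ⟨by rw [dartSteps_reverse, List.nodup_reverse]; exact nodup_dartSteps_lineWalk i R _,
        by rw [dartSteps_reverse, List.nodup_reverse]; exact nodup_dartSteps_lineWalk j T x, fun a ha b hb hab => ?_⟩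
      obtain ⟨k, -, rfl⟩ := hC a ha
      obtain ⟨k', -, rfl⟩ := hD b hb
      exact hij (congrArg Prod.snd hab)
    · -- B vs (C ++ D)
      obtain ⟨k, hk, rfl⟩ := hB a ha
      rcases List.mem_append.1 hb with hb | hb
      · obtain ⟨k', -, rfl⟩ := hC b hb
        exact hij (congrArg Prod.snd hab).symm
      · exact hBD b ⟨k, hk, hab.symm⟩ (hD b hb)
  · -- A vs (B ++ C ++ D)
    obtain ⟨k, hk, rfl⟩ := hA a ha
    rcases List.mem_append.1 hb with hb | hb
    · obtain ⟨k', -, rfl⟩ := hB b hb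
      exact hij (congrArg Prod.snd hab)
    · rcases List.mem_append.1 hb with hb | hb
      · exact hAC b ⟨k, hk, hab.symm⟩ (hC b hb)
      · obtain ⟨k', -, rfl⟩ := hD b hb
        exact hij (congrArg Prod.snd hab)

/-- **A non-degenerate lattice rectangle is a closed trail.** -/
theorem isTrail_rectWalk (x : Site d) {i j : Fin d} (hij : i ≠ j) {R T : ℕ} (hR : 1 ≤ R) (hT : 1 ≤ T) :
    (rectWalk x i j R T).IsTrail :=
  (isTrail_iff_nodup_dartSteps _).2 (nodup_dartSteps_rectWalk hij hR hT)

/-- **The rectangle family sits inside the trail family**: every `rectLoop i` is a `trailLoop j`. -/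
theorem rectLoop_mem_range_trailLoop (i : RectIdx d) : rectLoop i ∈ Set.range (trailLoop (d := d)) := by
  refine ⟨⟨rectLoop i, ?_, ?_⟩, rfl⟩
  · exact isTrail_rectWalk _ (ne_of_lt i.1.2.2) (Nat.succ_pos _) (Nat.succ_pos _)
  · change 0 < (rectWalk i.1.1 i.1.2.1.1 i.1.2.1.2 (i.2.1 + 1) (i.2.2 + 1)).length
    rw [length_rectWalk]; omega

end Summit.Ventures.YMGap.RobustBall

end
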